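import Literature.Topology.FourManifolds.ComplexProjectiveSpaceMorse
import Literature.AlgebraicGeometry.HodgeTheory.LeviForm
import Literature.FieldTheory.QuasiAlgClosed.Basic
import Mathlib.RingTheory.MvPolynomial.Homogeneous
import HarnessLib

/-!
# The Morse functions `g_a = (Σ a_p |ℓ_p(z)|²)(z^*z)^{d-1}/|F(z)|²` on `{F ≠ 0} ⊂ ℂℙᴺ`, read in an
# affine chart: smoothness, the index bound and the immersion property (Voisin II §1.2.1–1.2.2)

Third brick of the Morse-theoretic (Andreotti–Frankel) input for
`Voisin2003_smoothHypersurface_algebraicClasses_eq_top_holds` (see `LeviForm.lean`,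
`HypersurfaceLefschetzFromVanishing.lean`).  C. Voisin, *Hodge Theory and Complex Algebraic
Geometry II* (CUP 2003), §1.2.1–1.2.2 (PDF pp. 58–59 of the held copy): on an affine variety the
squared distance to a generic point is a Morse function (Lemma 1.17) whose indices are at most the
complex dimension (Prop. 1.19), and it is proper (proof of Thm. 1.22).  For the affine variety
`U_F = ℂℙᴺ ∖ V(F)` (`deg F = d ≥ 1`) we use instead the functions, homogeneous of degree `0`,

  `g_a([z]) = (Σ_p a_p |ℓ_p(z)|²) · (Σ_j |z_j|²)^{d-1} / |F(z)|²`,  `a ∈ ℝ^P`,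

where `ℓ_p`, `p = (j, k, s) ∈ P = [N+1] × [N+1] × [2]`, is the linear form `z_j + z_k` (`s = 0`) or
`z_j + i z_k` (`s = 1`): for `a_p > 0` the first factor is `‖B_a z‖²` with `B_a` complex linear and
injective, so that in the affine chart `z = (1, w)` (slot `i`) the numerator is
`‖b + L x‖² · ‖b₁ + L₁ x‖^{2(d-1)}` (affine maps into Hermitian spaces) and the denominator is
`|g(w)|²` with `g` a polynomial: by `LeviForm.lean` the `J`-averaged Hessian of `g_a` at a critical
point is positive, so the Morse index is `≤ N` (Prop. 1.19), and the coordinate functions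
`[z] ↦ |ℓ_p(z)|² (z^*z)^{d-1}/|F|²` immerse `U_F` in `ℝ^P` (so that almost every `g_a` — a height
function of this immersion — is a Morse function, Guillemin–Pollack Ch. 1 §7, the tree's
`MorseHeightFunctions.lean`).  This file is the chart-level calculus; the manifold-level statements
are in `HypersurfaceComplementMorse.lean`.

## Main results (chart `i`, real coordinates `x ∈ ℝ^{2N}` of `w ∈ ℂᴺ`, `z = homV i x = (…, 1ᵢ, …)`)

* `contDiff_eval_insertNth` — `w ↦ F(insertNth i 1 w)` is complex-smooth;
* `hChart_eq_div`, `contDiffAt_hChart` — `g_a` in the chart is `N_a / P`, smooth where `P ≠ 0`;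
* `hessian_hChart_add_pos` — at a critical point `x` of the chart expression `h` of `g_a`
  (`a_p > 0`), `D²h(u,u) + D²h(Ju,Ju) > 0` for `u ≠ 0`; `two_mul_sigNeg_hessian_hChart_le`:
  `2 · sigNeg (Hess h) ≤ 2N`;
* `injective_fderiv_coordChart` — the chart expression of `[z] ↦ (|ℓ_p(z)|² (z^*z)^{d-1}/|F|²)_p`
  has injective differential where `F ≠ 0`;
* `numerV_pos`, `le_numerV` — positivity and the lower bound `N_a(z) ≥ 4δ (z^*z)^d` behind properness.

## References

* [VoisinHodgeII2003] C. Voisin, Hodge Theory and Complex Algebraic Geometry II (CUP 2003), §1.2.1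
  Lemma 1.17 (PDF p. 57), Prop. 1.19, Lemma 1.20 (PDF p. 58), §1.2.2 Thm. 1.22 (PDF p. 59).
* [Milnor1963] J. Milnor, Morse theory (1963), §6 Thm. 6.6, §7 Thm. 7.2.
* [GuilleminPollack2010] V. Guillemin, A. Pollack, Differential topology (1974), Ch. 1 §7.
-/

noncomputable section

open scoped Topology InnerProductSpace ComplexConjugate
open Filter Module Set Function

namespace Literature.AlgebraicGeometry.HodgeTheory

namespace HypersurfaceComplement

open Literature.Topology.FourManifolds Literature.Topology.FourManifolds.ComplexProjectiveSpace

/-- Local notation: `𝔼 n` is the model Euclidean space `EuclideanSpace ℝ (Fin n)`. -/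
local notation "𝔼 " n:arg => EuclideanSpace ℝ (Fin n)

variable {N : ℕ}

/-! ### The linear forms `ℓ_p` and the vector-level functions -/

/-- The index set `P = [N+1] × [N+1] × [2]` of the linear forms `ℓ_p`. [folklore] -/
abbrev LIdx (N : ℕ) : Type := Fin (N + 1) × Fin (N + 1) × Fin 2

/-- The coefficient `c_s`: `1` for `s = 0`, `i` for `s = 1`. [folklore] -/
def coefC (s : Fin 2) : ℂ := if s = 0 then 1 else Complex.I

/-- `|c_s| = 1`. [folklore] -/
theorem norm_coefC (s : Fin 2) : ‖coefC s‖ = 1 := by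
  unfold coefC; split_ifs <;> simp

/-- The linear form `ℓ_p(z) = z_j + c_s z_k`, `p = (j, k, s)`, as a continuous `ℂ`-linear map.
[folklore] -/
def lfL (p : LIdx N) : (Fin (N + 1) → ℂ) →L[ℂ] ℂ :=
  ContinuousLinearMap.proj p.1 + coefC p.2.2 • ContinuousLinearMap.proj p.2.1

/-- `ℓ_p(z) = z_j + c_s z_k`. [folklore] -/
theorem lfL_apply (p : LIdx N) (z : Fin (N + 1) → ℂ) : lfL p z = z p.1 + coefC p.2.2 * z p.2.1 := rfl

/-- The diagonal forms: `ℓ_{(j,j,0)}(z) = 2 z_j`. [folklore] -/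
theorem lfL_diag (j : Fin (N + 1)) (z : Fin (N + 1) → ℂ) : lfL (j, j, 0) z = 2 * z j := by
  rw [lfL_apply]; simp [coefC]; ring

/-- `Σ_j |z_j|²`, the Hermitian square norm of `z ∈ ℂ^{N+1}`. [folklore] -/
def sqn (z : Fin (N + 1) → ℂ) : ℝ := ∑ j, ‖z j‖ ^ 2

/-- `Σ_j |z_j|² = ‖z‖²` for the Euclidean norm. [folklore] -/
theorem sqn_eq_norm_sq (z : Fin (N + 1) → ℂ) : sqn z = ‖WithLp.toLp 2 z‖ ^ 2 := by
  rw [sqn, EuclideanSpace.norm_sq_eq]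

/-- `Σ_j |z_j|² ≥ 0`. [folklore] -/
theorem sqn_nonneg (z : Fin (N + 1) → ℂ) : 0 ≤ sqn z :=
  Finset.sum_nonneg fun _ _ => by positivity

/-- `Σ_j |z_j|² > 0` for `z ≠ 0`. [folklore] -/
theorem sqn_pos {z : Fin (N + 1) → ℂ} (hz : z ≠ 0) : 0 < sqn z := by
  obtain ⟨j, hj⟩ := Function.ne_iff.1 hz
  exact lt_of_lt_of_le (by positivity : 0 < ‖z j‖ ^ 2)
    (Finset.single_le_sum (f := fun k => ‖z k‖ ^ 2) (fun k _ => by positivity) (Finset.mem_univ j))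

/-- `|z_j|² ≤ Σ_k |z_k|²`. [folklore] -/
theorem norm_sq_le_sqn (z : Fin (N + 1) → ℂ) (j : Fin (N + 1)) : ‖z j‖ ^ 2 ≤ sqn z :=
  Finset.single_le_sum (f := fun k => ‖z k‖ ^ 2) (fun k _ => by positivity) (Finset.mem_univ j)

/-- `Σ_j |c z_j|² = |c|² Σ_j |z_j|²`. [folklore] -/
theorem sqn_smul (c : ℂ) (z : Fin (N + 1) → ℂ) : sqn (c • z) = ‖c‖ ^ 2 * sqn z := by
  simp only [sqn, Pi.smul_apply, smul_eq_mul, norm_mul, mul_pow, Finset.mul_sum]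

/-- **The numerator `N_a(z) = (Σ_p a_p |ℓ_p(z)|²) (Σ_j |z_j|²)^{d-1}`** of `g_a` (degree `d` in `z`
and in `z̄`). [folklore] -/
def numerV (d : ℕ) (a : EuclideanSpace ℝ (LIdx N)) (z : Fin (N + 1) → ℂ) : ℝ :=
  (∑ p, a p * ‖lfL p z‖ ^ 2) * sqn z ^ (d - 1)

/-- **The denominator `P(z) = |F(z)|²`** of `g_a`. [folklore] -/
def denV (F : MvPolynomial (Fin (N + 1)) ℂ) (z : Fin (N + 1) → ℂ) : ℝ :=
  ‖MvPolynomial.eval z F‖ ^ 2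

/-- The coordinate functions `|ℓ_p(z)|² (Σ|z_j|²)^{d-1} / |F(z)|²` (whose linear combinations
with coefficients `a` are `g_a = N_a / P`). [folklore] -/
def coordV (F : MvPolynomial (Fin (N + 1)) ℂ) (d : ℕ) (p : LIdx N) (z : Fin (N + 1) → ℂ) : ℝ :=
  ‖lfL p z‖ ^ 2 * sqn z ^ (d - 1) / denV F z

/-- `Σ_p a_p |ℓ_p(z)|² ≥ 0` for `a ≥ 0`. [folklore] -/
theorem sum_mul_norm_sq_nonneg {a : EuclideanSpace ℝ (LIdx N)} (ha : ∀ p, 0 ≤ a p)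
    (z : Fin (N + 1) → ℂ) : 0 ≤ ∑ p, a p * ‖lfL p z‖ ^ 2 :=
  Finset.sum_nonneg fun p _ => mul_nonneg (ha p) (by positivity)

/-- **The lower bound `Σ_p a_p |ℓ_p(z)|² ≥ 4 δ Σ_j |z_j|²`** when `a_p ≥ δ ≥ 0` (from the diagonal
forms `ℓ_{(j,j,0)} = 2 z_j`): the first factor of `N_a` is a positive definite Hermitian form.
[folklore] -/
theorem le_sum_mul_norm_sq {a : EuclideanSpace ℝ (LIdx N)} {δ : ℝ} (hδ : 0 ≤ δ)
    (ha : ∀ p, δ ≤ a p) (z : Fin (N + 1) → ℂ) : 4 * δ * sqn z ≤ ∑ p, a p * ‖lfL p z‖ ^ 2 := by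
  classical
  have hnn : ∀ p, 0 ≤ a p * ‖lfL p z‖ ^ 2 := fun p => mul_nonneg (hδ.trans (ha p)) (by positivity)
  -- restrict the sum to the diagonal indices `(j, j, 0)`
  set ι : Fin (N + 1) → LIdx N := fun j => (j, j, 0) with hι
  have hinj : Function.Injective ι := fun j j' h => by simpa [hι] using congrArg Prod.fst h
  calc 4 * δ * sqn z = ∑ j, δ * ‖lfL (ι j) z‖ ^ 2 := by
        rw [sqn, Finset.mul_sum]
        refine Finset.sum_congr rfl fun j _ => ?_
        rw [hι, lfL_diag, norm_mul, Complex.norm_ofNat]; ring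
    _ ≤ ∑ j, a (ι j) * ‖lfL (ι j) z‖ ^ 2 :=
        Finset.sum_le_sum fun j _ => mul_le_mul_of_nonneg_right (ha _) (by positivity)
    _ = ∑ p ∈ Finset.univ.image ι, a p * ‖lfL p z‖ ^ 2 := by
        rw [Finset.sum_image fun j _ j' _ h => hinj h]
    _ ≤ ∑ p, a p * ‖lfL p z‖ ^ 2 :=
        Finset.sum_le_sum_of_subset_of_nonneg (Finset.subset_univ _) fun p _ _ => hnn p

/-- **`N_a(z) ≥ 4δ (Σ_j|z_j|²)ᵈ`** for `a_p ≥ δ ≥ 0` and `d ≥ 1` (properness of `g_a`: near `F = 0`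
the numerator stays bounded below on the sphere). [cite: VoisinHodgeII2003, §1.2.2 proof of Thm. 1.22 (properness), PDF p. 59] -/
theorem le_numerV {d : ℕ} (hd : 1 ≤ d) {a : EuclideanSpace ℝ (LIdx N)} {δ : ℝ} (hδ : 0 ≤ δ)
    (ha : ∀ p, δ ≤ a p) (z : Fin (N + 1) → ℂ) : 4 * δ * sqn z ^ d ≤ numerV d a z := by
  rw [numerV]
  obtain ⟨k, rfl⟩ : ∃ k, d = k + 1 := ⟨d - 1, by omega⟩
  rw [Nat.add_sub_cancel, pow_succ']
  have := le_sum_mul_norm_sq hδ ha z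
  have hs := sqn_nonneg z
  nlinarith [pow_nonneg hs k, mul_le_mul_of_nonneg_right this (pow_nonneg hs k)]

/-- **`N_a(z) > 0` for `z ≠ 0`** when all `a_p > 0`. [folklore] -/
theorem numerV_pos {d : ℕ} (hd : 1 ≤ d) {a : EuclideanSpace ℝ (LIdx N)} (ha : ∀ p, 0 < a p)
    {z : Fin (N + 1) → ℂ} (hz : z ≠ 0) : 0 < numerV d a z := by
  classical
  obtain ⟨δ, hδ, hle⟩ : ∃ δ : ℝ, 0 < δ ∧ ∀ p, δ ≤ a p := by
    obtain ⟨p₀, -, hp₀⟩ := Finset.exists_min_image Finset.univ (fun p => a p) Finset.univ_nonempty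
    exact ⟨a p₀, ha p₀, fun p => hp₀ p (Finset.mem_univ p)⟩
  have h := le_numerV hd hδ.le hle z
  have hs := sqn_pos hz
  have : 0 < 4 * δ * sqn z ^ d := by positivity
  linarith

/-- `N_a(z) ≥ 0` for `a ≥ 0`. [folklore] -/
theorem numerV_nonneg (d : ℕ) {a : EuclideanSpace ℝ (LIdx N)} (ha : ∀ p, 0 ≤ a p)
    (z : Fin (N + 1) → ℂ) : 0 ≤ numerV d a z :=
  mul_nonneg (sum_mul_norm_sq_nonneg ha z) (pow_nonneg (sqn_nonneg z) _)

/-! ### Homogeneity -/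

/-- `Σ_p a_p |ℓ_p(c z)|² = |c|² Σ_p a_p |ℓ_p(z)|²`. [folklore] -/
theorem sum_mul_norm_sq_smul (a : EuclideanSpace ℝ (LIdx N)) (c : ℂ) (z : Fin (N + 1) → ℂ) :
    ∑ p, a p * ‖lfL p (c • z)‖ ^ 2 = ‖c‖ ^ 2 * ∑ p, a p * ‖lfL p z‖ ^ 2 := by
  rw [Finset.mul_sum]
  refine Finset.sum_congr rfl fun p _ => ?_
  rw [map_smul, smul_eq_mul, norm_mul]; ring

/-- `N_a(c z) = |c|^{2d} N_a(z)` (`d ≥ 1`). [folklore] -/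
theorem numerV_smul {d : ℕ} (hd : 1 ≤ d) (a : EuclideanSpace ℝ (LIdx N)) (c : ℂ)
    (z : Fin (N + 1) → ℂ) : numerV d a (c • z) = (‖c‖ ^ 2) ^ d * numerV d a z := by
  obtain ⟨k, rfl⟩ : ∃ k, d = k + 1 := ⟨d - 1, by omega⟩
  rw [numerV, numerV, Nat.add_sub_cancel, sum_mul_norm_sq_smul, sqn_smul, mul_pow, pow_succ']
  ring

/-- `P(c z) = |c|^{2d} P(z)` for `F` homogeneous of degree `d`. [folklore] -/
theorem denV_smul {F : MvPolynomial (Fin (N + 1)) ℂ} {d : ℕ} (hF : F.IsHomogeneous d) (c : ℂ)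
    (z : Fin (N + 1) → ℂ) : denV F (c • z) = (‖c‖ ^ 2) ^ d * denV F z := by
  rw [denV, denV, hF.eval_smul_eq, norm_mul, norm_pow, mul_pow, ← pow_mul, ← pow_mul, mul_comm 2 d]

/-- `|ℓ_p(c z)|² (Σ|c z_j|²)^{d-1} = |c|^{2d} |ℓ_p(z)|² (Σ|z_j|²)^{d-1}` (`d ≥ 1`). [folklore] -/
theorem coordNumer_smul {d : ℕ} (hd : 1 ≤ d) (p : LIdx N) (c : ℂ) (z : Fin (N + 1) → ℂ) :
    ‖lfL p (c • z)‖ ^ 2 * sqn (c • z) ^ (d - 1) = (‖c‖ ^ 2) ^ d * (‖lfL p z‖ ^ 2 * sqn z ^ (d - 1)) := by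
  obtain ⟨k, rfl⟩ : ∃ k, d = k + 1 := ⟨d - 1, by omega⟩
  rw [Nat.add_sub_cancel, map_smul, smul_eq_mul, norm_mul, sqn_smul, mul_pow, mul_pow, pow_succ']
  ring

/-- **`g_a = N_a / P` is homogeneous of degree `0`**: `N_a(cz)/P(cz) = N_a(z)/P(z)` for `c ≠ 0`.
[folklore] -/
theorem numerV_div_denV_smul {F : MvPolynomial (Fin (N + 1)) ℂ} {d : ℕ} (hF : F.IsHomogeneous d)
    (hd : 1 ≤ d) (a : EuclideanSpace ℝ (LIdx N)) {c : ℂ} (hc : c ≠ 0) (z : Fin (N + 1) → ℂ) :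
    numerV d a (c • z) / denV F (c • z) = numerV d a z / denV F z := by
  rw [numerV_smul hd, denV_smul hF]
  exact mul_div_mul_left _ _ (pow_ne_zero _ (by positivity))

/-- The coordinate functions are homogeneous of degree `0`. [folklore] -/
theorem coordV_smul {F : MvPolynomial (Fin (N + 1)) ℂ} {d : ℕ} (hF : F.IsHomogeneous d)
    (hd : 1 ≤ d) (p : LIdx N) {c : ℂ} (hc : c ≠ 0) (z : Fin (N + 1) → ℂ) :
    coordV F d p (c • z) = coordV F d p z := by
  rw [coordV, coordV, coordNumer_smul hd, denV_smul hF]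
  exact mul_div_mul_left _ _ (pow_ne_zero _ (by positivity))

/-- `N_a / P = Σ_p a_p · coordV_p`. [folklore] -/
theorem numerV_div_denV_eq_sum (F : MvPolynomial (Fin (N + 1)) ℂ) (d : ℕ)
    (a : EuclideanSpace ℝ (LIdx N)) (z : Fin (N + 1) → ℂ) :
    numerV d a z / denV F z = ∑ p, a p * coordV F d p z := by
  rw [numerV, Finset.sum_mul, Finset.sum_div]
  refine Finset.sum_congr rfl fun p _ => ?_
  rw [coordV]; ring

/-! ### The injective linear map `B_a` with `‖B_a z‖² = Σ_p a_p |ℓ_p(z)|²` -/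

/-- **`B_a : ℂ^{N+1} → ℂ^P`, `(B_a z)_p = √a_p · ℓ_p(z)`**, a complex linear map into the
Hermitian space `ℂ^P` with `‖B_a z‖² = Σ_p a_p |ℓ_p(z)|²` for `a ≥ 0`. [folklore] -/
def bMap (a : EuclideanSpace ℝ (LIdx N)) : (Fin (N + 1) → ℂ) →L[ℂ] EuclideanSpace ℂ (LIdx N) :=
  (EuclideanSpace.equiv (LIdx N) ℂ).symm.toContinuousLinearMap.comp
    (ContinuousLinearMap.pi fun p => ((Real.sqrt (a p) : ℝ) : ℂ) • lfL p)

/-- `(B_a z)_p = √a_p ℓ_p(z)`. [folklore] -/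
@[simp] theorem bMap_apply (a : EuclideanSpace ℝ (LIdx N)) (z : Fin (N + 1) → ℂ) (p : LIdx N) :
    bMap a z p = (Real.sqrt (a p) : ℂ) * lfL p z := rfl

/-- `‖B_a z‖² = Σ_p a_p |ℓ_p(z)|²` for `a ≥ 0`. [folklore] -/
theorem norm_bMap_sq {a : EuclideanSpace ℝ (LIdx N)} (ha : ∀ p, 0 ≤ a p) (z : Fin (N + 1) → ℂ) :
    ‖bMap a z‖ ^ 2 = ∑ p, a p * ‖lfL p z‖ ^ 2 := by
  rw [EuclideanSpace.norm_sq_eq]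
  refine Finset.sum_congr rfl fun p _ => ?_
  rw [bMap_apply, norm_mul, Complex.norm_real, Real.norm_eq_abs, abs_of_nonneg (Real.sqrt_nonneg _),
    mul_pow, Real.sq_sqrt (ha p)]

/-- **`B_a` is injective for `a > 0`** (it contains the coordinates `2√a · z_j`). [folklore] -/
theorem bMap_injective {a : EuclideanSpace ℝ (LIdx N)} (ha : ∀ p, 0 < a p) :
    Function.Injective (bMap a) := by
  refine (injective_iff_map_eq_zero _).2 fun z hz => ?_
  funext j
  have h := congrArg (fun v : EuclideanSpace ℂ (LIdx N) => v (j, j, 0)) hz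
  simp only [bMap_apply, lfL_diag, PiLp.zero_apply, mul_eq_zero, Complex.ofReal_eq_zero,
    (Real.sqrt_pos.2 (ha _)).ne', false_or, OfNat.ofNat_ne_zero] at h
  exact h

/-! ### Polynomial evaluation on an affine chart is complex-smooth -/

/-- **`w ↦ F(insertNth i 1 w)` is complex-smooth** (a polynomial in `w`). [folklore] -/
theorem contDiff_eval_insertNth (i : Fin (N + 1)) (F : MvPolynomial (Fin (N + 1)) ℂ)
    {n : WithTop ℕ∞} :
    ContDiff ℂ n (fun w : Fin N → ℂ => MvPolynomial.eval (Fin.insertNth i 1 w) F) := by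
  induction F using MvPolynomial.induction_on with
  | C a => simpa using contDiff_const
  | add p q hp hq => simpa [map_add] using hp.add hq
  | mul_X p j hp =>
    simp only [map_mul, MvPolynomial.eval_X]
    refine hp.mul ?_
    rcases Fin.eq_self_or_eq_succAbove i j with rfl | ⟨k, rfl⟩
    · simp only [Fin.insertNth_apply_same]
      exact contDiff_const
    · simp only [Fin.insertNth_apply_succAbove]
      exact contDiff_apply ℂ ℂ k

/-! ### Chart-level objects (affine chart `i`, real coordinates) -/

section Chart

variable (N)

/-- Multiplication by `c ∈ ℂ` on `ℂᴺ`, transported to the real coordinates `ℝ^{2N}`. [folklore] -/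
def smulCLM (c : ℂ) : 𝔼 (2 * N) →L[ℝ] 𝔼 (2 * N) :=
  (realCoordinates N : (Fin N → ℂ) →L[ℝ] 𝔼 (2 * N)).comp
    (((c • ContinuousLinearMap.id ℂ (Fin N → ℂ)).restrictScalars ℝ).comp
      ((realCoordinates N).symm : 𝔼 (2 * N) →L[ℝ] (Fin N → ℂ)))

/-- `smulCLM c u = realCoordinates (c • realCoordinates⁻¹ u)`. [folklore] -/
theorem smulCLM_apply (c : ℂ) (u : 𝔼 (2 * N)) :
    smulCLM N c u = realCoordinates N (c • (realCoordinates N).symm u) := rfl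

/-- **`J`: multiplication by `i` on `ℂᴺ` in the real coordinates `ℝ^{2N}`**, a linear automorphism
with inverse multiplication by `-i`. [folklore] -/
def Jop : 𝔼 (2 * N) ≃L[ℝ] 𝔼 (2 * N) :=
  ContinuousLinearEquiv.equivOfInverse (smulCLM N Complex.I) (smulCLM N (-Complex.I))
    (fun u => by simp [smulCLM_apply, smul_smul])
    (fun u => by simp [smulCLM_apply, smul_smul])

/-- `realCoordinates⁻¹ (J u) = i · realCoordinates⁻¹ u`. [folklore] -/
theorem realCoordinates_symm_Jop (u : 𝔼 (2 * N)) :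
    (realCoordinates N).symm (Jop N u) = Complex.I • (realCoordinates N).symm u := by
  change (realCoordinates N).symm (smulCLM N Complex.I u) = _
  rw [smulCLM_apply, ContinuousLinearEquiv.symm_apply_apply]

variable {N}

/-- **Insertion of `0` in slot `i`**, `w ↦ insertNth i 0 w : ℂᴺ → ℂ^{N+1}`, as a continuous
complex-linear map. [folklore] -/
def insLin (i : Fin (N + 1)) : (Fin N → ℂ) →L[ℂ] (Fin (N + 1) → ℂ) :=
  LinearMap.toContinuousLinearMap
    { toFun := fun w => Fin.insertNth i (0 : ℂ) w
      map_add' := fun p q => by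
        have h := Fin.insertNth_add (α := fun _ => ℂ) i (0 : ℂ) 0 p q
        rwa [add_zero] at h
      map_smul' := fun c p => by
        funext j
        rcases Fin.eq_self_or_eq_succAbove i j with rfl | ⟨k, rfl⟩
        · simp [Fin.insertNth_apply_same]
        · simp [Fin.insertNth_apply_succAbove] }

/-- `insLin i w = insertNth i 0 w`. [folklore] -/
@[simp] theorem insLin_apply (i : Fin (N + 1)) (w : Fin N → ℂ) : insLin i w = Fin.insertNth i 0 w := rfl

/-- **The linear part `L_i : ℝ^{2N} → ℂ^{N+1}` of the homogenisation**, `x ↦ insertNth i 0 (rc⁻¹ x)`.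
[folklore] -/
def linI (i : Fin (N + 1)) : 𝔼 (2 * N) →L[ℝ] (Fin (N + 1) → ℂ) :=
  ((insLin i).restrictScalars ℝ).comp ((realCoordinates N).symm : 𝔼 (2 * N) →L[ℝ] (Fin N → ℂ))

/-- `linI i x = insertNth i 0 (rc⁻¹ x)`. [folklore] -/
theorem linI_apply (i : Fin (N + 1)) (x : 𝔼 (2 * N)) :
    linI i x = Fin.insertNth i 0 ((realCoordinates N).symm x) := rfl

/-- **Homogenisation in real coordinates**: `homV i x = insertNth i 1 (rc⁻¹ x) ∈ ℂ^{N+1}`, the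
homogeneous coordinates with `1` in slot `i` of the point of `ℂℙᴺ` with affine coordinates `x`.
[folklore] -/
def homV (i : Fin (N + 1)) (x : 𝔼 (2 * N)) : Fin (N + 1) → ℂ :=
  Fin.insertNth i 1 ((realCoordinates N).symm x)

/-- `homV i x = (homogenize i (rc⁻¹ x) : ℂ^{N+1})` (the tree's homogenisation). [folklore] -/
theorem homV_eq_homogenize (i : Fin (N + 1)) (x : 𝔼 (2 * N)) :
    homV i x = (homogenize i ((realCoordinates N).symm x) : Fin (N + 1) → ℂ) := rfl

/-- **`homV i` is affine**: `homV i x = e_i + L_i x`. [folklore] -/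
theorem homV_eq (i : Fin (N + 1)) (x : 𝔼 (2 * N)) : homV i x = Pi.single i 1 + linI i x := by
  funext j
  rcases Fin.eq_self_or_eq_succAbove i j with rfl | ⟨k, rfl⟩
  · simp [homV, linI_apply]
  · simp [homV, linI_apply, Fin.succAbove_ne]

/-- `(homV i x)_i = 1`. [folklore] -/
@[simp] theorem homV_apply_self (i : Fin (N + 1)) (x : 𝔼 (2 * N)) : homV i x i = 1 := by
  simp [homV]

/-- `(homV i x)_{i↑j} = (rc⁻¹ x)_j`. [folklore] -/
@[simp] theorem homV_apply_succAbove (i : Fin (N + 1)) (x : 𝔼 (2 * N)) (j : Fin N) :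
    homV i x (i.succAbove j) = (realCoordinates N).symm x j := by
  simp [homV]

/-- `(linI i u)_i = 0`. [folklore] -/
@[simp] theorem linI_apply_self (i : Fin (N + 1)) (u : 𝔼 (2 * N)) : linI i u i = 0 := by
  simp [linI_apply]

/-- `(linI i u)_{i↑j} = (rc⁻¹ u)_j`. [folklore] -/
@[simp] theorem linI_apply_succAbove (i : Fin (N + 1)) (u : 𝔼 (2 * N)) (j : Fin N) :
    linI i u (i.succAbove j) = (realCoordinates N).symm u j := by
  simp [linI_apply]

/-- `homV i x ≠ 0`. [folklore] -/
theorem homV_ne_zero (i : Fin (N + 1)) (x : 𝔼 (2 * N)) : homV i x ≠ 0 := fun h => by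
  simpa using congr_fun h i

/-- `linI i u = 0 ↔ u = 0`. [folklore] -/
theorem linI_eq_zero_iff (i : Fin (N + 1)) (u : 𝔼 (2 * N)) : linI i u = 0 ↔ u = 0 := by
  constructor
  · intro h
    have hw : (realCoordinates N).symm u = 0 := by
      funext j
      have := congr_fun h (i.succAbove j)
      simpa using this
    simpa using congrArg (realCoordinates N) hw
  · rintro rfl; simp

/-- **`L_i (J u) = i · L_i u`**: the linear part of the homogenisation is complex linear for the
complex structure `J`. [folklore] -/
theorem linI_Jop (i : Fin (N + 1)) (u : 𝔼 (2 * N)) : linI i (Jop N u) = Complex.I • linI i u := by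
  rw [linI, ContinuousLinearMap.comp_apply, ContinuousLinearMap.comp_apply]
  change insLin i ((realCoordinates N).symm (Jop N u)) = Complex.I • insLin i ((realCoordinates N).symm u)
  rw [realCoordinates_symm_Jop, map_smul]

/-- `homV i x` and `L_i u`, `u ≠ 0`, are `ℂ`-linearly independent (look at slot `i`). [folklore] -/
theorem linI_ne_smul_homV (i : Fin (N + 1)) (x : 𝔼 (2 * N)) {u : 𝔼 (2 * N)} (hu : u ≠ 0) (r : ℂ) :
    linI i u ≠ r • homV i x := by
  intro h
  have hi := congr_fun h i
  simp only [linI_apply_self, Pi.smul_apply, homV_apply_self, smul_eq_mul, mul_one] at hi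
  rw [← hi, zero_smul] at h
  exact hu ((linI_eq_zero_iff i u).1 h)


/-! ### The chart expressions of `g_a` and of the coordinate functions -/

section ChartFunctions

variable (i : Fin (N + 1)) (F : MvPolynomial (Fin (N + 1)) ℂ) (d : ℕ)

/-- `F` on the affine chart: `g(w) = F(insertNth i 1 w)`, a polynomial in `w ∈ ℂᴺ`. [folklore] -/
def gPoly (w : Fin N → ℂ) : ℂ := MvPolynomial.eval (Fin.insertNth i 1 w) F

/-- `g` is complex-smooth. [folklore] -/
theorem contDiff_gPoly {n : WithTop ℕ∞} : ContDiff ℂ n (gPoly i F) := contDiff_eval_insertNth i F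

/-- **The denominator `P = |F|²` in the chart**: `denC x = |F(homV i x)|² = |g(rc⁻¹ x)|²`. [folklore] -/
def denC (x : 𝔼 (2 * N)) : ℝ := denV F (homV i x)

/-- `denC = |g ∘ rc⁻¹|²` as functions (definitional). [folklore] -/
theorem denC_eq : denC i F = fun x =>
    ‖gPoly i F (((realCoordinates N).symm : 𝔼 (2 * N) →L[ℝ] (Fin N → ℂ)) x)‖ ^ 2 := rfl

/-- `denC` is smooth. [folklore] -/
theorem contDiff_denC {n : WithTop ℕ∞} : ContDiff ℝ n (denC i F) := by
  rw [denC_eq]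
  exact (((contDiff_gPoly i F).restrict_scalars ℝ).comp
    ((realCoordinates N).symm : 𝔼 (2 * N) →L[ℝ] (Fin N → ℂ)).contDiff).norm_sq ℂ

/-- **The Hermitian factor `q_a(x) = Σ_p a_p |ℓ_p(homV i x)|²` of the numerator in the chart.**
[folklore] -/
def qC (a : EuclideanSpace ℝ (LIdx N)) (x : 𝔼 (2 * N)) : ℝ := ∑ p, a p * ‖lfL p (homV i x)‖ ^ 2

/-- `|ℓ_p ∘ homV i|²` is the squared norm of an affine map into `ℂ`. [folklore] -/
theorem norm_sq_lfL_homV_eq (p : LIdx N) : (fun x : 𝔼 (2 * N) => ‖lfL p (homV i x)‖ ^ 2) =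
    fun x => ‖lfL p (Pi.single i 1) + (((lfL p).restrictScalars ℝ).comp (linI i)) x‖ ^ 2 := by
  funext x; rw [homV_eq, map_add]; rfl

/-- `q_a` is smooth. [folklore] -/
theorem contDiff_qC (a : EuclideanSpace ℝ (LIdx N)) {n : WithTop ℕ∞} : ContDiff ℝ n (qC i a) := by
  unfold qC
  refine ContDiff.sum fun p _ => contDiff_const.mul ?_
  rw [norm_sq_lfL_homV_eq]
  exact contDiff_norm_sq_affine _ _

/-- **`q_a = ‖b + L ·‖²`** with `b = B_a e_i`, `L = B_a ∘ L_i` (for `a ≥ 0`). [folklore] -/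
theorem qC_eq_norm_sq {a : EuclideanSpace ℝ (LIdx N)} (ha : ∀ p, 0 ≤ a p) :
    qC i a = fun x => ‖bMap a (Pi.single i 1) + (((bMap a).restrictScalars ℝ).comp (linI i)) x‖ ^ 2 := by
  funext x
  rw [qC, ← norm_bMap_sq ha, homV_eq, map_add]
  rfl

/-- **The factor `s(x) = Σ_j |(homV i x)_j|²` of the numerator in the chart.** [folklore] -/
def sC (x : 𝔼 (2 * N)) : ℝ := sqn (homV i x)

/-- **`s = ‖b₁ + L₁ ·‖²`** with `b₁ = e_i`, `L₁ = L_i` read in the Hermitian space `ℂ^{N+1}`.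
[folklore] -/
theorem sC_eq_norm_sq : sC i = fun x : 𝔼 (2 * N) =>
    ‖(EuclideanSpace.equiv (Fin (N + 1)) ℂ).symm (Pi.single i 1) +
      ((((EuclideanSpace.equiv (Fin (N + 1)) ℂ).symm.toContinuousLinearMap).restrictScalars ℝ).comp
        (linI i)) x‖ ^ 2 := by
  funext x
  rw [sC, sqn_eq_norm_sq, homV_eq]
  rfl

/-- `s` is smooth. [folklore] -/
theorem contDiff_sC {n : WithTop ℕ∞} : ContDiff ℝ n (sC i (N := N)) := by
  rw [sC_eq_norm_sq]; exact contDiff_norm_sq_affine _ _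

/-- `s > 0`. [folklore] -/
theorem sC_pos (x : 𝔼 (2 * N)) : 0 < sC i x := sqn_pos (homV_ne_zero i x)

/-- **The numerator in the chart**: `N_a(homV i x) = q_a(x) · s(x)^{d-1}` (definitional). [folklore] -/
theorem numerV_homV_eq (a : EuclideanSpace ℝ (LIdx N)) :
    (fun x : 𝔼 (2 * N) => numerV d a (homV i x)) = fun x => qC i a x * sC i x ^ (d - 1) := rfl

/-- **The chart expression `h = g_a ∘ (affine chart)⁻¹ = N_a / P` of `g_a`.** [folklore] -/
def hC (a : EuclideanSpace ℝ (LIdx N)) (x : 𝔼 (2 * N)) : ℝ := numerV d a (homV i x) / denV F (homV i x)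

/-- `h = (q_a · s^{d-1}) / P`. [folklore] -/
theorem hC_eq (a : EuclideanSpace ℝ (LIdx N)) :
    hC i F d a = fun x => qC i a x * sC i x ^ (d - 1) / denC i F x := rfl

/-- `h` is smooth where `P ≠ 0`. [folklore] -/
theorem contDiffAt_hC (a : EuclideanSpace ℝ (LIdx N)) {x : 𝔼 (2 * N)} (hx : denV F (homV i x) ≠ 0)
    {n : WithTop ℕ∞} : ContDiffAt ℝ n (hC i F d a) x := by
  rw [hC_eq]
  exact (((contDiff_qC i a).mul ((contDiff_sC i).pow _)).contDiffAt).div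
    (contDiff_denC i F).contDiffAt hx

/-- `h` is smooth on `{P ≠ 0}`. [folklore] -/
theorem contDiffOn_hC (a : EuclideanSpace ℝ (LIdx N)) {n : WithTop ℕ∞} :
    ContDiffOn ℝ n (hC i F d a) {x | denV F (homV i x) ≠ 0} := fun _ hx =>
  (contDiffAt_hC i F d a hx).contDiffWithinAt

/-- **The chart expression of the coordinate functions**, `x ↦ (|ℓ_p|² s^{d-1} / P)_p ∈ ℝ^P`.
[folklore] -/
def coordC (x : 𝔼 (2 * N)) : EuclideanSpace ℝ (LIdx N) :=
  (EuclideanSpace.equiv (LIdx N) ℝ).symm fun p => coordV F d p (homV i x)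

/-- The `p`-th coordinate of `coordC`. [folklore] -/
@[simp] theorem coordC_apply (x : 𝔼 (2 * N)) (p : LIdx N) :
    coordC i F d x p = coordV F d p (homV i x) := rfl

/-- `h = ⟪a, coordC⟫`: the chart expression of `g_a` is the height function of `coordC` in the
direction `a`. [folklore] -/
theorem hC_eq_inner (a : EuclideanSpace ℝ (LIdx N)) (x : 𝔼 (2 * N)) :
    hC i F d a x = ⟪a, coordC i F d x⟫_ℝ := by
  rw [hC, numerV_div_denV_eq_sum, PiLp.inner_apply]
  refine Finset.sum_congr rfl fun p _ => ?_
  rw [coordC_apply, real_inner_eq_re_inner ℝ]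
  simp [mul_comm]

/-- The coordinate `p` of `coordC` as `|ℓ_p(homV)|² · τ`, `τ = s^{d-1}/P`. [folklore] -/
theorem coordC_apply_eq (x : 𝔼 (2 * N)) (p : LIdx N) :
    coordC i F d x p = ‖lfL p (homV i x)‖ ^ 2 * (sC i x ^ (d - 1) / denC i F x) := by
  rw [coordC_apply, coordV, mul_div_assoc]; rfl

/-- `coordC` is smooth on `{P ≠ 0}`. [folklore] -/
theorem contDiffOn_coordC {n : WithTop ℕ∞} :
    ContDiffOn ℝ n (coordC i F d) {x | denV F (homV i x) ≠ 0} := by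
  have h : coordC i F d = (EuclideanSpace.equiv (LIdx N) ℝ).symm ∘
      fun x p => ‖lfL p (homV i x)‖ ^ 2 * (sC i x ^ (d - 1) / denC i F x) := by
    funext x; ext p; exact coordC_apply_eq i F d x p
  rw [h]
  refine (EuclideanSpace.equiv (LIdx N) ℝ).symm.contDiff.comp_contDiffOn (contDiffOn_pi.2 fun p => ?_)
  refine ContDiffOn.mul ?_ ?_
  · rw [norm_sq_lfL_homV_eq]; exact (contDiff_norm_sq_affine _ _).contDiffOn
  · exact (((contDiff_sC i).pow _).contDiffOn).div (contDiff_denC i F).contDiffOn fun x hx => hx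

end ChartFunctions

/-! ### The index bound (Voisin II, Prop. 1.19) for `g_a` in the chart -/

section IndexBound

variable (i : Fin (N + 1)) (F : MvPolynomial (Fin (N + 1)) ℂ) {d : ℕ} {a : EuclideanSpace ℝ (LIdx N)}

/-- **`leviNum P = 0`** for the denominator `P = |g ∘ rc⁻¹|²` (`log |g|²` is pluriharmonic).
[cite: VoisinHodgeII2003, §1.2.1 proof of Prop. 1.19 (PDF p. 58)] -/
theorem leviNum_denC_eq_zero (x u : 𝔼 (2 * N)) :
    leviNum (Jop N : 𝔼 (2 * N) →L[ℝ] 𝔼 (2 * N)) (denC i F) x u = 0 := by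
  rw [denC_eq]
  exact leviNum_normSq_comp_clm_eq_zero _ (contDiff_gPoly i F) _ (realCoordinates_symm_Jop N u)

/-- **`leviNum s ≥ 0`** for `s = ‖e_i + L_i ·‖²`. [cite: VoisinHodgeII2003, §1.2.1 proof of Prop. 1.19 (PDF p. 58)] -/
theorem leviNum_sC_nonneg (x u : 𝔼 (2 * N)) :
    0 ≤ leviNum (Jop N : 𝔼 (2 * N) →L[ℝ] 𝔼 (2 * N)) (sC i) x u := by
  rw [sC_eq_norm_sq]
  refine leviNum_norm_sq_affine_nonneg _ _ _ x u ?_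
  change (EuclideanSpace.equiv (Fin (N + 1)) ℂ).symm (linI i (Jop N u)) =
    Complex.I • (EuclideanSpace.equiv (Fin (N + 1)) ℂ).symm (linI i u)
  rw [linI_Jop, map_smul]

/-- **`leviNum q_a > 0`** for `u ≠ 0` when all `a_p > 0` (`q_a = ‖B_a(e_i + L_i ·)‖²` with `B_a`
injective; strict Cauchy–Schwarz). [cite: VoisinHodgeII2003, §1.2.1 proof of Prop. 1.19 (PDF p. 58)] -/
theorem leviNum_qC_pos (ha : ∀ p, 0 < a p) (x : 𝔼 (2 * N)) {u : 𝔼 (2 * N)} (hu : u ≠ 0) :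
    0 < leviNum (Jop N : 𝔼 (2 * N) →L[ℝ] 𝔼 (2 * N)) (qC i a) x u := by
  have hinj := bMap_injective ha
  rw [qC_eq_norm_sq i fun p => (ha p).le]
  refine leviNum_norm_sq_affine_pos _ _ _ x u ?_ ?_ ?_ ?_
  · change bMap a (linI i (Jop N u)) = Complex.I • bMap a (linI i u)
    rw [linI_Jop, map_smul]
  · change bMap a (Pi.single i 1) + bMap a (linI i x) ≠ 0
    rw [← map_add, ← homV_eq, Ne, map_eq_zero_iff _ hinj]
    exact homV_ne_zero i x
  · change bMap a (linI i u) ≠ 0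
    rw [Ne, map_eq_zero_iff _ hinj, linI_eq_zero_iff]
    exact hu
  · intro r h
    change bMap a (linI i u) = r • (bMap a (Pi.single i 1) + bMap a (linI i x)) at h
    rw [← map_add, ← homV_eq, ← map_smul, hinj.eq_iff] at h
    exact linI_ne_smul_homV i x hu r h

/-- **`leviNum N_a > 0`** for the numerator `N_a = q_a · s^{d-1}`, `u ≠ 0`, `a > 0`:
`leviNum N_a = q_a² leviNum (s^{d-1}) + s^{2(d-1)} leviNum q_a ≥ s^{2(d-1)} leviNum q_a > 0`.
[cite: VoisinHodgeII2003, §1.2.1 proof of Prop. 1.19 (PDF p. 58)] -/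
theorem leviNum_numer_pos (ha : ∀ p, 0 < a p) (x : 𝔼 (2 * N)) {u : 𝔼 (2 * N)} (hu : u ≠ 0) :
    0 < leviNum (Jop N : 𝔼 (2 * N) →L[ℝ] 𝔼 (2 * N)) (fun y => numerV d a (homV i y)) x u := by
  have hq : ContDiffAt ℝ 2 (qC i a) x := (contDiff_qC i a).contDiffAt
  have hs : ContDiffAt ℝ 2 (sC i (N := N)) x := (contDiff_sC i).contDiffAt
  have hsp : ContDiffAt ℝ 2 (fun y => sC i y ^ (d - 1)) x := hs.pow _
  rw [numerV_homV_eq, leviNum_mul _ hq hsp u]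
  have h1 : 0 ≤ leviNum (Jop N : 𝔼 (2 * N) →L[ℝ] 𝔼 (2 * N)) (fun y => sC i y ^ (d - 1)) x u :=
    leviNum_pow_nonneg _ hs u (leviNum_sC_nonneg i x u) _
  have h2 := leviNum_qC_pos i ha x hu
  have h3 : 0 < sC i x ^ (d - 1) := pow_pos (sC_pos i x) _
  nlinarith [mul_nonneg (sq_nonneg (qC i a x)) h1, mul_pos (pow_pos h3 2) h2]

/-- **Voisin II, Prop. 1.19 for `g_a` on `U_F`, in the chart**: at a critical point `x` of the
chart expression `h` of `g_a` (all `a_p > 0`, `F(homV i x) ≠ 0`, `d ≥ 1`), for every `u ≠ 0`,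
`D²h(u, u) + D²h(Ju, Ju) > 0`. [cite: VoisinHodgeII2003, §1.2.1 Prop. 1.19, §1.2.2 Thm. 1.22 (PDF pp. 58–59)] -/
theorem hessian_hC_add_pos (hd : 1 ≤ d) (ha : ∀ p, 0 < a p) {x : 𝔼 (2 * N)}
    (hx : denV F (homV i x) ≠ 0) (hcrit : fderiv ℝ (hC i F d a) x = 0) {u : 𝔼 (2 * N)} (hu : u ≠ 0) :
    0 < fderiv ℝ (fun y => fderiv ℝ (hC i F d a) y) x u u +
      fderiv ℝ (fun y => fderiv ℝ (hC i F d a) y) x (Jop N u) (Jop N u) := by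
  have hPx : 0 < denC i F x := lt_of_le_of_ne (by unfold denC denV; positivity) (Ne.symm hx)
  have hNx : 0 < numerV d a (homV i x) := numerV_pos hd ha (homV_ne_zero i x)
  have hhx : 0 < hC i F d a x := div_pos hNx hPx
  have hopen : IsOpen {y : 𝔼 (2 * N) | denC i F y ≠ 0} :=
    isOpen_ne_fun (contDiff_denC i F (n := 0)).continuous continuous_const
  have hN : (fun y => numerV d a (homV i y)) =ᶠ[𝓝 x] fun y => hC i F d a y * denC i F y := by
    filter_upwards [hopen.mem_nhds hx] with y hy
    change numerV d a (homV i y) = numerV d a (homV i y) / denC i F y * denC i F y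
    rw [div_mul_cancel₀ _ hy]
  exact hessian_add_hessian_pos_of_isCriticalPt _ (contDiffAt_hC i F d a hx)
    (contDiff_denC i F).contDiffAt hN hhx hPx hcrit u (leviNum_denC_eq_zero i F x u)
    (leviNum_numer_pos i ha x hu)

/-- **The index bound in the chart**: at a critical point of the chart expression `h` of `g_a`
(all `a_p > 0`, `F ≠ 0` there, `d ≥ 1`), the Hessian of `h` has `2 · sigNeg ≤ 2N`, i.e. Morse
index `≤ N = dim_ℂ U_F` (Voisin II Prop. 1.19 with Lemma 1.20).
[cite: VoisinHodgeII2003, §1.2.1 Prop. 1.19 and Lemma 1.20 (PDF p. 58)] -/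
theorem two_mul_sigNeg_hessian_hC_le (hd : 1 ≤ d) (ha : ∀ p, 0 < a p) {x : 𝔼 (2 * N)}
    (hx : denV F (homV i x) ≠ 0) (hcrit : fderiv ℝ (hC i F d a) x = 0) :
    2 * sigNeg (LinearMap.BilinMap.toQuadraticMap ((ContinuousLinearMap.coeLM ℝ).comp
        (fderiv ℝ (fun y => fderiv ℝ (hC i F d a) y) x).toLinearMap)) ≤ 2 * N := by
  have h := two_mul_sigNeg_hessian_le_finrank (Jop N) (h := hC i F d a) (x := x)
    fun u hu => hessian_hC_add_pos i F hd ha hx hcrit hu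
  rwa [finrank_euclideanSpace_fin] at h

end IndexBound


/-! ### The immersion property of the coordinate functions in the chart -/

section Immersion

variable (i : Fin (N + 1)) (F : MvPolynomial (Fin (N + 1)) ℂ) (d : ℕ)

/-- `D(|ℓ_p ∘ homV i|²)ₓ(u) = 2 Re (conj(ℓ_p(homV i x)) · ℓ_p(L_i u))`. [folklore] -/
theorem fderiv_norm_sq_lfL_homV_apply (p : LIdx N) (x u : 𝔼 (2 * N)) :
    fderiv ℝ (fun y => ‖lfL p (homV i y)‖ ^ 2) x u =
      2 * (conj (lfL p (homV i x)) * lfL p (linI i u)).re := by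
  rw [norm_sq_lfL_homV_eq, fderiv_norm_sq_affine_apply, RCLike.inner_apply']
  simp only [ContinuousLinearMap.comp_apply, ContinuousLinearMap.coe_restrictScalars', ← map_add,
    ← homV_eq]

/-- `|ℓ_p ∘ homV i|²` is differentiable. [folklore] -/
theorem differentiableAt_norm_sq_lfL_homV (p : LIdx N) (x : 𝔼 (2 * N)) :
    DifferentiableAt ℝ (fun y => ‖lfL p (homV i y)‖ ^ 2) x := by
  rw [norm_sq_lfL_homV_eq]; exact (contDiff_norm_sq_affine _ _ (n := 1)).differentiable one_ne_zero x

/-- The linear algebra of the immersion proof: if `Re(conj(2W) 2V) = 0`, `Re(conj(1 + W) V) = 0` and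
`Re(conj(1 + iW) iV) = 0`, then `V = 0`. [folklore] -/
theorem eq_zero_of_re_mul_conditions {W V : ℂ} (e1 : (conj (W + W) * (V + V)).re = 0)
    (e2 : (conj (1 + W) * V).re = 0)
    (e3 : (conj (1 + Complex.I * W) * (Complex.I * V)).re = 0) : V = 0 := by
  simp only [Complex.mul_re, Complex.add_re, Complex.add_im, Complex.conj_re, Complex.conj_im,
    Complex.one_re, Complex.one_im, Complex.I_re, Complex.I_im, Complex.mul_im, zero_mul, one_mul,
    zero_add, zero_sub] at e1 e2 e3
  apply Complex.ext
  · simp only [Complex.zero_re]; nlinarith [e1, e2, e3]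
  · simp only [Complex.zero_im]; nlinarith [e1, e2, e3]

/-- **The coordinate functions immerse `U_F`** (chart form): where `F(homV i x) ≠ 0` (`d ≥ 1`),
the differential of `x ↦ (|ℓ_p(homV i x)|² s^{d-1}/P)_p ∈ ℝ^P` is injective.  Writing the
coordinates as `|ℓ_p|² · τ`, `τ = s^{d-1}/P > 0`: the coordinate `p = (i,i,0)` is `4τ`, so
`Dτ(u) = 0`; then `Re(conj ℓ_p(homV i x) · ℓ_p(L_i u)) = 0` for all `p`, and the three families
`2z_k`, `z_i + z_k`, `z_i + i z_k` force `L_i u = 0`.  (This is what makes the functions `g_a`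
height functions of an immersion, so that almost all of them are Morse functions:
Guillemin–Pollack Ch. 1 §7; Voisin II Lemma 1.17.) [cite: VoisinHodgeII2003, §1.2.1 Lemma 1.17 (PDF p. 57)] -/
theorem injective_fderiv_coordC {x : 𝔼 (2 * N)} (hx : denV F (homV i x) ≠ 0) :
    Function.Injective (fderiv ℝ (coordC i F d) x) := by
  have hPx : 0 < denC i F x := lt_of_le_of_ne (by unfold denC denV; positivity) (Ne.symm hx)
  have hopen : IsOpen {y : 𝔼 (2 * N) | denV F (homV i y) ≠ 0} :=
    isOpen_ne_fun (contDiff_denC i F (n := 0)).continuous continuous_const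
  -- `τ = s^{d-1} / P`
  set τ : 𝔼 (2 * N) → ℝ := fun y => sC i y ^ (d - 1) / denC i F y with hτ
  have hτx : 0 < τ x := div_pos (pow_pos (sC_pos i x) _) hPx
  have hτc : ContDiffAt ℝ 1 τ x :=
    (((contDiff_sC i (N := N)).pow (d - 1)).contDiffAt).div (contDiff_denC i F).contDiffAt
      (show denC i F x ≠ 0 from hx)
  have hτd : DifferentiableAt ℝ τ x := hτc.differentiableAt one_ne_zero
  have hcoord : ∀ p, (fun y => coordC i F d y p) = fun y => ‖lfL p (homV i y)‖ ^ 2 * τ y :=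
    fun p => funext fun y => coordC_apply_eq i F d y p
  have hGd : DifferentiableAt ℝ (coordC i F d) x :=
    ((contDiffOn_coordC i F d (n := 1)).differentiableOn one_ne_zero x hx).differentiableAt
      (hopen.mem_nhds hx)
  refine (injective_iff_map_eq_zero _).2 fun u hu => ?_
  -- each coordinate of the derivative vanishes
  have hcp : ∀ p, fderiv ℝ (fun y => coordC i F d y p) x u = 0 := fun p => by
    have h : HasFDerivAt ((EuclideanSpace.proj p : EuclideanSpace ℝ (LIdx N) →L[ℝ] ℝ) ∘ coordC i F d)
        ((EuclideanSpace.proj p : EuclideanSpace ℝ (LIdx N) →L[ℝ] ℝ).comp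
          (fderiv ℝ (coordC i F d) x)) x :=
      (EuclideanSpace.proj p : EuclideanSpace ℝ (LIdx N) →L[ℝ] ℝ).hasFDerivAt.comp x hGd.hasFDerivAt
    rw [show (fun y => coordC i F d y p) =
      ((EuclideanSpace.proj p : EuclideanSpace ℝ (LIdx N) →L[ℝ] ℝ) ∘ coordC i F d) from rfl,
      h.fderiv, ContinuousLinearMap.comp_apply, hu, map_zero]
  -- product rule
  have hexp : ∀ p, ‖lfL p (homV i x)‖ ^ 2 * fderiv ℝ τ x u +
      τ x * (2 * (conj (lfL p (homV i x)) * lfL p (linI i u)).re) = 0 := fun p => by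
    have h := hcp p
    rw [hcoord p, fderiv_fun_mul (differentiableAt_norm_sq_lfL_homV i p x) hτd] at h
    simpa only [FunLike.coe_add, Pi.add_apply, FunLike.coe_smul, Pi.smul_apply, smul_eq_mul,
      fderiv_norm_sq_lfL_homV_apply] using h
  -- the coordinate `(i, i, 0)`: `Dτ(u) = 0`
  have h0 : fderiv ℝ τ x u = 0 := by
    have h := hexp (i, i, 0)
    rw [lfL_diag, lfL_diag, homV_apply_self, linI_apply_self] at h
    norm_num at h
    exact h
  -- hence `Re(conj ℓ_p(homV i x) ℓ_p(L_i u)) = 0` for all `p`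
  have hre : ∀ p, (conj (lfL p (homV i x)) * lfL p (linI i u)).re = 0 := fun p => by
    have h := hexp p
    rw [h0, mul_zero, zero_add] at h
    rcases mul_eq_zero.1 h with h1 | h1
    · exact absurd h1 hτx.ne'
    · linarith
  -- read off `L_i u = 0`
  have hυ : (realCoordinates N).symm u = 0 := by
    funext j
    have e1 := hre (i.succAbove j, i.succAbove j, 0)
    have e2 := hre (i, i.succAbove j, 0)
    have e3 := hre (i, i.succAbove j, 1)
    simp only [lfL_apply, coefC, homV_apply_self, homV_apply_succAbove, linI_apply_self,
      linI_apply_succAbove, Fin.isValue, ↓reduceIte, one_mul, zero_add,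
      show ((1 : Fin 2) = 0) = False by decide] at e1 e2 e3
    exact eq_zero_of_re_mul_conditions e1 e2 e3
  simpa using congrArg (realCoordinates N) hυ

end Immersion

end Chart

end HypersurfaceComplement

end Literature.AlgebraicGeometry.HodgeTheory
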